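import Literature.IUT.HodgeArakelov.ThetaEvaluationCor112AtModelTateSectionStd
import Literature.IUT.HodgeArakelov.BadPrimeGaussianMonoidsGenuineRecordAtModelTateRecord
import Literature.IUT.HodgeArakelov.ThetaEvaluationSettingIotaProofs
import Literature.IUT.HodgeArakelov.ThetaEvaluationSettingModelProofs
import HarnessLib

/-!
# [IUTchII] Cor. 1.12 (ii)∧(iii) AT THE TATE MODEL, `D_{μ_-} :=` the `ι`-fixed Galois section — the PROP. 2.2 (ii) TRANSLATES of the
# standard class are THEOREMS; residual = the ANABELIAN inputs only (proof-only; D-0079 K-L6)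

S. Mochizuki, *Inter-universal Teichmüller theory II*, kurims manuscript (Dec. 2020), Cor. 1.12 (ii), (iii) pp. 56–58, Prop. 2.2 (ii)
p. 66 («the unique `{(l·ℤ)×μ_{2l}}`-orbit», «invariance with respect to `ι`»), Rmk. 2.1.1 (i) p. 65 [claim: Mochizuki2012, status: disputed]
(IUTchII §1 Cor 1.12, kurims pp.56-58); S. Mochizuki, *The étale theta function …*, Publ. RIMS **45** (2009) [EtTh], Prop. 1.4 (i)–(iii)
pp. 20–22, Prop. 1.5 (ii), (iii) p. 23, Def. 2.7 p. 41 [cite: MochizukiEtTh2009, Prop 1.4 (ii) p.20].  Cell `abc-iut`, seat abc-iut-w4-d043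
(gen 8), row «TRANSLATES-AT-SECTION» (STATUS 23:44:57Z) — third sequel of `ThetaEvaluationCor112AtModelTateSection` (p472143) after
`ThetaRootClassAtModelTateSection` (p475423) / `ThetaEvaluationCor112AtModelTateSectionStd` (p476151).  PROOF-ONLY: no definition, no
instance, no new named fact; every input a LANDED theorem consumed BY NAME — abc-iut-w4-d004 `rootLevel_inputs_of_classLevel_orbit`,
abc-iut-w4-d010 `orbitOne_desc_of_sign` / `hrev_of_transport` / `conj_rootLiftClass_of_mem_GtpY` / `h14sign_of_prop15iii` /
`h14orbit_of_h14fix` / `h14free_of_prop15_of_origin` / `exists_deck_element`, abc-iut-w5-d072 `pairRho_h1Top_symm` /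
`autMap_comap_etaDd_eq_self_modelχq` / `toLZ_inversionAlpha_generator`, abc-iut-L2-t8 `prop13_prop15_sectionData_modelTate` (Prop. 1.5 (ii) at
the section datum), abc-iut-L2-d1 `isInversionAut_inversionχq` / `thetaIso_inversionχq_apply_eq_self`.

WHAT.
* §1 **`translates_rootMember_modelχq`** (every stage-2 model `modelχq p i j hj`, every `E` with `E.etaDd = η̈♯`, every `ι`-stable
  `X̲̲`-choice `C`, every theta companion `ι^Θ`, every (H1) witness, every `toLZ`-generator `γ`): for the translates `tr n := γⁿ · η̲̈^Θ`
  (the `γⁿ`-conjugates of the ROOT class) — `hdesc` (the orbit `η̈^{Θ,l·ℤ×μ₂}` = the translates up to `2`-torsion), `hrev` (the pair action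
  `pairRho` of `(ι|Π^tp_{X̲̲}, ι^Θ)` carries `tr n` to `tr (−n)` up to torsion), `hfree` (distinct translates differ by non-torsion classes),
  GIVEN [EtTh] Prop. 1.5 (iii)/(ii) for `E` (at the Tate instance both are theorems).
* §2 **`ModelTateCarriers.cor112_model_modelTate_section_translates`** — p476151's telescope with `tr htr hdesc hrev hfree` DISCHARGED in the proof
  (`translates_rootMember_modelχq`; `h15ii :=` `prop13_prop15_sectionData_modelTate` at the `inr`-section datum of record).  Residual `∀`-binders EXACTLY
  {`hP` (inhabited), `h218i₁` = F-0620 ([EtTh] Cor. 2.18 (i)) at level `1`, (H1) `hcharY` = F-2633 at the instance, (R1) `huniq` (uniqueness of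
  the pointed inversion), (H1) `hΔX` (⟺ MChar, p466815), the isomorph `G`} — i.e. ONLY the tempered-anabelian inputs of record; every
  other binder of this lineage's Cor. 1.12 model closer is a THEOREM or a datum of the tree at this carrier, and the conclusion is under
  no empty binder.

HONEST LABEL: `modelTate` is a SEMI-SYNTHETIC model of the typed [EtTh] §1 interface (no theta FUNCTION; not the tempered `π₁` of a curve):
binder-discharge / joint-satisfiability evidence for the typed interface, not a statement about print; nothing of [IUTchII] (claim key
`Mochizuki2012`, DISPUTED, D-0012) or [EtTh] asserted beyond the tree's proofs; F-0620 / F-2633 / `huniq` / MChar stay NAMED; no side is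
taken on [IUTchIII] Cor. 3.12; typed ≠ proved; instantiated ≠ endorsed; nothing here says abc is proved or refuted.
-/

noncomputable section

namespace Literature.IUT.HodgeArakelov

open Literature.AnabelianGeometry.AbsoluteAnabelian
open Literature.AnabelianGeometry.EtaleTheta Literature.AnabelianGeometry.SemiGraphs CohomologySystemOfContH1
open Literature.AnabelianGeometry.EtaleTheta.SettingModel
open Literature.NumberTheory.GaloisRepresentations
open scoped Literature.AnabelianGeometry.EtaleTheta
open EtaleThetaDataOfSetting

namespace ModelTateCarriers

/-! ## §1. The Prop. 2.2 (ii) translates of the root class at the stage-2 models -/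

section Translates

variable (p : ℕ) [Fact p.Prime] (i j : ℤ) (hj : Even j)
  {E : (ThetaSetting.modelχq p i j hj).EtaleThetaData} {l : ℕ} (C : E.DoubleUnderline l)
  [((ThetaSetting.modelχq p i j hj).lDeltaTheta l).Normal] [IsMulCommutative ((ThetaSetting.modelχq p i j hj).lDeltaTheta l)]

/-- **The Prop. 2.2 (ii) translates of the ROOT class at the stage-2 models** — `hdesc` (orbit = translates up to `2`-torsion), `hrev` (for
abc-iut-w5-d072's pair action `pairRho` of `(ι|Π^tp_{X̲̲}, ι^Θ)`: `tr n ↦ tr (−n)` up to torsion), `hfree` (distinct translates differ by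
non-torsion classes) for `tr n := γⁿ · η̲̈^Θ`, GIVEN [EtTh] Prop. 1.5 (iii)/(ii) for `E` — abc-iut-w4-d004's `rootLevel_inputs_of_classLevel_orbit`
fed by the landed model facts, then abc-iut-w4-d010's `orbitOne_desc_of_sign` / `hrev_of_transport`.
[claim: Mochizuki2012, status: disputed] (IUTchII §2 Prop 2.2 (ii), kurims p.66) -/
theorem translates_rootMember_modelχq (hE : E.etaDd = etaDdχq p i j hj)
    (hS : (ThetaSetting.modelχq p i j hj).Sec2Hyps)
    (h15 : ThetaSetting.Prop15iii E (compat_modelχq p i j hj))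
    (h15ii : ThetaSetting.Prop15ii E.toKummerData (compat_modelχq p i j hj))
    (hι : C.Huu.map (inversionχq p i j).toMulEquiv.toMonoidHom = C.Huu)
    (cι : ThetaSetting.ThetaCompanion (Dα := ThetaSetting.modelχq p i j hj) (Dβ := ThetaSetting.modelχq p i j hj)
      (inversionχq p i j))
    (hcharY : PiYddCharacteristic C) (γ : Pi C) (hγ : C.toLZ γ = Multiplicative.ofAdd 1)
    (hφ : ∀ g, cι.thetaIso (phi C g) = phi C (inversionAlpha C (inversionχq p i j) hι g))
    (hAβ : ∀ a : (ThetaSetting.modelχq p i j hj).GtpTheta,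
      a ∈ (ThetaSetting.modelχq p i j hj).lDeltaTheta l ↔ cι.thetaIso a ∈ (ThetaSetting.modelχq p i j hj).lDeltaTheta l) :
    haveI := piYdd_normal C (compat_modelχq p i j hj)
    (∀ o ∈ orbitOne C (compat_modelχq p i j hj), ∃ (n : ℤ) (c' : (coh C).H1 ⊤), 2 • c' = 0 ∧
        o = (h1Top C).symm (Additive.ofMul
          (ContH1.conj (phi C) ((ThetaSetting.modelχq p i j hj).lDeltaTheta l) (γ ^ n) (rootLiftClass C))) + c') ∧
      (∀ n : ℤ, IsOfFinAddOrder
        (pairRho C (inversionAlpha C (inversionχq p i j) hι) cι.thetaIso hφ hAβ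
            (mem_PiYdd_iff_of_piYddCharacteristic C hcharY _)
            ((h1Top C).symm (Additive.ofMul
              (ContH1.conj (phi C) ((ThetaSetting.modelχq p i j hj).lDeltaTheta l) (γ ^ n) (rootLiftClass C)))) -
          (h1Top C).symm (Additive.ofMul
            (ContH1.conj (phi C) ((ThetaSetting.modelχq p i j hj).lDeltaTheta l) (γ ^ (-n)) (rootLiftClass C))))) ∧
      (∀ m n : ℤ, IsOfFinAddOrder
        ((h1Top C).symm (Additive.ofMul
            (ContH1.conj (phi C) ((ThetaSetting.modelχq p i j hj).lDeltaTheta l) (γ ^ m) (rootLiftClass C))) -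
          (h1Top C).symm (Additive.ofMul
            (ContH1.conj (phi C) ((ThetaSetting.modelχq p i j hj).lDeltaTheta l) (γ ^ n) (rootLiftClass C)))) → m = n) := by
  haveI := piYdd_normal C (compat_modelχq p i j hj)
  haveI := (compat_modelχq p i j hj).GtpYdd_normal
  obtain ⟨ε, hε₁, hε₂⟩ := exists_deck_element C hS
  have hH := mem_PiYdd_iff_of_piYddCharacteristic C hcharY (inversionAlpha C (inversionχq p i j) hι)
  obtain ⟨hsign, ⟨τ₀, hτ₀Y, hroot⟩, hfreeτ⟩ := rootLevel_inputs_of_classLevel_orbit C (inversionχq p i j) hι cι hS hcharY γ ε hγ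
    hε₁ hε₂ 1
    (fun x => by
      rw [OneMemClass.coe_one, one_mul, inv_one, mul_one]
      exact inversionχq_inversionχq p i j _)
    (fun a ha => by
      rw [thetaIso_inversionχq_apply_eq_self p i j hj cι ha, mul_inv_cancel]
      exact Subgroup.one_mem _)
    (h14sign_of_prop15iii C (compat_modelχq p i j hj) hS h15 ε hε₁)
    (h14orbit_of_h14fix C (inversionχq p i j) hι cι hcharY
      (autMap_comap_etaDd_eq_self_modelχq p i j hj E hE C hι cι hH))
    (h14free_of_prop15_of_origin C (compat_modelχq p i j hj) (ThetaSetting.modelχq_isEtThOrigin p i j hj) h15 h15ii γ hγ)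
  refine ⟨orbitOne_desc_of_sign C (compat_modelχq p i j hj) hS γ ε hγ hε₁ hε₂ hsign, fun n => ?_, hfreeτ⟩
  obtain ⟨t, htfin, ht⟩ := conj_rootLiftClass_of_mem_GtpY C hS ε hε₁ hε₂ hsign τ₀ hτ₀Y
  have hZι : (ThetaSetting.modelχq p i j hj).toZ (inversionχq p i j (γ : (ThetaSetting.modelχq p i j hj).PiTemp)) =
      ((ThetaSetting.modelχq p i j hj).toZ (γ : (ThetaSetting.modelχq p i j hj).PiTemp))⁻¹ :=
    (isInversionAut_inversionχq p i j hj).toZ_apply _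
  exact hrev_of_transport C hS γ ε hγ hε₁ hε₂ hsign (inversionAlpha C (inversionχq p i j) hι) cι.thetaIso hφ
    (fun a ha => (hAβ a).mp ha) hH (toLZ_inversionAlpha_generator C (inversionχq p i j) hι γ hγ hZι)
    ⟨t, htfin, hroot.trans ht⟩ (pairRho C _ cι.thetaIso hφ hAβ hH) (pairRho_h1Top_symm C _ cι.thetaIso hφ hAβ hH) n

end Translates

/-! ## §2. The instance: the translates discharged — residual = the anabelian inputs only -/

section Tate

variable (p : ℕ) [Fact p.Prime] (l : ℕ+) (hl : Odd (l : ℕ)) (hlp : (l : ℕ).Prime) (hdvd : 4 * (l : ℕ) ∣ p - 1)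
  {Es : Set ℕ+} (τ : (ThetaSetting.modelχq p 1 2 even_two).CyclotomeTower l Es)

/-- **[IUTchII] Cor. 1.12 (ii) AND (iii) at the Tate model with `D_{μ_-} := Π^tp_{X̲̲} ∩ inr(G_{ℚ_p})` — EVERY non-anabelian binder a
THEOREM.**  p476151's `cor112_model_modelTate_section_std` with, in addition, the Prop. 2.2 (ii) translates of the standard class
`tr n := γⁿ · η̲̈^Θ`, `htr`, `hdesc`, `hrev`, `hfree` THEOREMS (`translates_rootMember_modelχq`; Prop. 1.5 (ii) at the section datum =
abc-iut-L2-t8's `prop13_prop15_sectionData_modelTate`).  Residual `∀`-binders, each a NAMED anabelian input: `hP` (inhabited), `h218i₁`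
(F-0620 at level `1`), (H1) `hcharY` (F-2633 at the instance), (R1) `huniq`, (H1) `hΔX` (⟺ MChar, p466815), `G`.  Conclusion VERBATIM
p472143's / p476151's at these data. [claim: Mochizuki2012, status: disputed] (IUTchII §1 Cor 1.12 (ii)(iii), kurims pp.56-58) -/
theorem cor112_model_modelTate_section_translates :
    -- the [EtTh] §1 data of record at the Tate model (every clause a theorem of abc-iut-L2)
    let hC := compat_modelχq p 1 2 even_two
    let hS := ThetaSetting.modelχq_sec2Hyps p 1 2 even_two
    -- (R1) AT THE TATE MODEL: abc-iut-L2's stage-2 inversion `ι := inversionχq` of `Π^tp_X` (over `K`, `−1` on `Z`, involutive)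
    let ι := inversionχq p 1 2
    let hιA : (ThetaSetting.modelχq p 1 2 even_two).IsInversionAut ι := isInversionAut_inversionχq p 1 2 even_two
    -- THE POINT `μ_-` OF THE MODEL: the Galois section of record `inr(G_{ℚ_p}) ≤ Π^tp_X`, FIXED by `ι` (its trace on `Π^tp_{X̲̲}` is `D_{μ_-}`)
    let Dsec : Subgroup (PiTpχq p 1 2) := (SemidirectProduct.inr : GQp p →* PiTpχq p 1 2).range
    let K₀ := (kummerCoreχq p 1 2 even_two).toKummerDataOfSection SemidirectProduct.inr (continuous_inrχq p 1 2)
        (fun _ => rfl) (map_inr_GK_le_GtpY_modelχq' p 1 2 even_two) (map_inr_GKdd_le_GtpYdd_modelχq' p 1 2 even_two)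
    let C := (K₀.etaleThetaDataOfClass (etaDdχq p 1 2 even_two)).doubleUnderlineχqOfEtaRes p 1 2 l hl
        (eta_res_etaDdχq p 1 2 even_two l hl)
    -- the ROOT COCYCLE of the `EtaleLevels` chain: abc-iut-L6-t1's one-root lift (abc-iut-w5-d233 `rootLift_mem_rootCocycles`)
    let f := EtaleThetaDataOfSetting.rootLift C
    let hf : f ∈ C.rootCocycles hC := rootLift_mem_rootCocycles C hC
    let h15 : Literature.AnabelianGeometry.EtaleTheta.ThetaSetting.Prop15iii _ hC :=
      prop15iii_etaleThetaDataOfClass_etaDdχq p hC SemidirectProduct.inr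
        (continuous_inrχq p 1 2) (fun _ => rfl) (map_inr_GK_le_GtpY_modelχq' p 1 2 even_two)
        (map_inr_GKdd_le_GtpYdd_modelχq' p 1 2 even_two)
    let L : C.CuspLabels := ⟨fun _ => ∅, fun _ => ∅, fun _ => rfl⟩
    let hO := ThetaSetting.modelχq_isEtThOrigin p 1 2 even_two
    let hYcl := hYcl_modelχq p 1 2 even_two
    let hp2 := ne_two_of_four_mul_dvd_pred p l.pos hdvd
    let hpl := ne_of_four_mul_dvd_pred p l.pos hdvd
    let hζ := exists_isPrimitiveRoot_K_modelχq p 1 2 even_two l.pos hdvd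
    let hZ : ∀ M : ℕ+, Nonempty (ModelCyclotomes.lDeltaQuot (C.rigidData (τ.modAll M) hC hS h15 L) ≃*
        Literature.IUT.HodgeTheaters.ZHat) := fun M =>
      ModelCyclotomes.nonempty_lDeltaQuot_rigidData_mulEquiv_zHat C (τ.modAll M) hC hS h15 L hO hYcl hlp.ne_zero
    -- the generic instances of the Cor. 1.12 vocabulary, re-supplied at the (reducible) Tate-model carriers
    haveI : ((ThetaSetting.modelχq p 1 2 even_two).lDeltaTheta l).Normal := (ThetaSetting.modelχq p 1 2 even_two).lDeltaTheta_normal l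
    haveI : IsMulCommutative ((ThetaSetting.modelχq p 1 2 even_two).lDeltaTheta l) :=
      EtaleThetaDataOfSetting.instIsMulCommutative_lDeltaTheta (D := ThetaSetting.modelχq p 1 2 even_two) l
    letI : MulDistribMulAction (EtaleThetaDataOfSetting.Pi C) (PadicAlgCl p)ˣ := EtaleThetaDataOfSetting.unitsAction C
    -- (H2) `Π/Δ ≅ G_K` at the `EtaleLevels` setting of the Tate model: abc-iut-w4-d030's THEOREM `hq_setting_modelTate` (p456925)
    let hq : Nonempty (TopGroup.quot (EtaleLevels.setting C hC hS hlp hp2 hpl hζ τ.modAll f hf).PiX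
        (EtaleLevels.setting C hC hS hlp hp2 hpl hζ τ.modAll f hf).DeltaX ≃ₜ*
        (EtaleLevels.setting C hC hS hlp hp2 hpl hζ τ.modAll f hf).Gk) :=
      hq_setting_modelTate p l hl hlp hdvd τ
    -- `ι` stabilises `Π^tp_X̲̲`; `α := ι|Π^tp_X̲̲` (abc-iut-w5-d072 `inversionAlpha`); `δ := 1`; a `toLZ`-generator `γ`
    let hι : C.Huu.map ι.toMulEquiv.toMonoidHom = C.Huu := map_Huuχq_inversionχq p 1 2 l hl
    let α : (EtaleThetaDataOfSetting.Pi C) ≃ₜ* (EtaleThetaDataOfSetting.Pi C) := EtaleThetaDataOfSetting.inversionAlpha C ι hι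
    let hαα : ∀ x : EtaleThetaDataOfSetting.Pi C, α (α x) = 1 * x * 1⁻¹ :=
      EtaleThetaDataOfSetting.inversionAlpha_inversionAlpha_of_sq C ι hι 1
        (EtaleThetaDataOfSetting.sq_conj_one_of_involutive C ι (inversionχq_inversionχq p 1 2))
    let γ : EtaleThetaDataOfSetting.Pi C := (C.toLZ_surjective (Multiplicative.ofAdd 1)).choose
    let hγ : C.toLZ γ = Multiplicative.ofAdd 1 := (C.toLZ_surjective (Multiplicative.ofAdd 1)).choose_spec
    let hαγ : C.toLZ (α γ) = Multiplicative.ofAdd (-1) :=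
      EtaleThetaDataOfSetting.toLZ_inversionAlpha_generator C ι hι γ hγ (hιA.toZ_apply γ)
    -- the [IUTchII] Prop. 1.2 (i) output `Env₀ :=` abc-iut-L6-d6's GENUINE `ThetaSetting.envOfGroup` of the Tate curve (bridge B8), for
    -- EVERY identification `hP` (inhabited: `⟨ContinuousMulEquiv.refl _⟩`); its `projG ∘ isoX` kills exactly `Ker(aug)` modulo F-0620
    ∀ (hP : Nonempty ((EtaleThetaDataOfSetting.Pi C) ≃ₜ* (EtaleLevels.setting C hC hS hlp hp2 hpl hζ τ.modAll f hf).PiX)),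
    let Env₀ : EnvOfGroup (EtaleLevels.setting C hC hS hlp hp2 hpl hζ τ.modAll f hf)
        (EtaleLevels.modelSystem C hC hS hlp hp2 hpl hζ τ.modAll f hf τ.red_modAll h15 L hZ).PiX :=
      ThetaSetting.envOfGroup (C.rigidData (τ.modAll 1) hC hS h15 L)
        (ThetaSetting.SideData.ofDoubleUnderline C (τ.modAll 1) hC hS hlp hp2 hpl hζ (EtaleLevels.eta0_mem C hC hS τ.modAll f hf 1))
        (ThetaSetting.t1Space_Huu C) (ThetaSetting.isClosed_ker_aug_thetaEnvData C (τ.modAll 1) hC hS) (hZ 1)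
        (EtaleThetaDataOfSetting.Pi C) hP
    let hδ : Env₀.recon.projG (Env₀.isoX 1) = 1 :=
      EtaleThetaDataOfSetting.projG_isoX_envOfGroup_one C (τ.modAll 1) hC hS h15 L hlp hp2 hpl hζ
        (EtaleLevels.eta0_mem C hC hS τ.modAll f hf 1) (hZ 1) hP
    -- RESIDUAL named inputs: F-0620 ([EtTh] Cor. 2.18 (i)) at level `1` of `τ` — from which `hover` FOLLOWS (p461458) — then (H1)
    -- `hcharY`, after which the POINT DATA of `D_{μ_-} := Π^tp_{X̲̲} ∩ inr(G_{ℚ_p})` are THEOREMS (§1), then the rest of the custody list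
    ∀ (h218i₁ : (C.rigidData (τ.modAll 1) hC hS h15 L).Cor218_i),
    let hover : ∀ x : EtaleThetaDataOfSetting.Pi C, Env₀.recon.projG (Env₀.isoX (α x)) = Env₀.recon.projG (Env₀.isoX x) :=
      fun x => EtaleThetaDataOfSetting.projG_isoX_envOfGroup_inversionAlpha_of_cor218_i C ι hι (τ.modAll 1) hC hS h15 L hlp
        hp2 hpl hζ (EtaleLevels.eta0_mem C hC hS τ.modAll f hf 1) (hZ 1) hP _ rfl h218i₁ hιA x
    ∀ (hcharY : EtaleThetaDataOfSetting.PiYddCharacteristic C),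
    -- «y = μ_-» AT THE MODEL, EVERY point clause a THEOREM: `D_{μ_-} := Π^tp_{X̲̲} ∩ inr(G_{ℚ_p})`, the `ι`-FIXED Galois section
    -- of record (`inversionχq_inr` at `(i, j) = (1, 2)`), inside `Π_Ÿ(Π)` since `K̈ = K` (`hDmu`), compact, `D_{μ_-} ∩ Δ = 1`,
    -- `aug(D_{μ_-}) = G_K`; «fixed by `ι_Ÿ` up to `Π_Ÿ(Π)`-conjugacy» with `δ' := 1` (`hfixD`)
    let Dμ : Subgroup (EtaleThetaDataOfSetting.Pi C) := Dsec.subgroupOf C.Huu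
    let hDmu : Dμ ≤ EtaleThetaDataOfSetting.PiYdd C := inrRange_subgroupOf_le_piYdd p 1 2 even_two C hS
    let hfixD : ∃ δ' : ↥(EtaleThetaDataOfSetting.PiYdd C), Env₀.recon.projG (Env₀.isoX (δ' : EtaleThetaDataOfSetting.Pi C)) = 1 ∧
        ∀ (d : EtaleThetaDataOfSetting.Pi C) (hd : d ∈ Dμ),
          ((EtaleThetaDataOfSetting.iotaYddOfAut C hcharY α ⟨d, hDmu hd⟩ :
          EtaleThetaDataOfSetting.PiYdd C) : EtaleThetaDataOfSetting.Pi C) ∈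
            Dμ.map (MulAut.conj ((δ' : EtaleThetaDataOfSetting.PiYdd C) : EtaleThetaDataOfSetting.Pi C)).toMonoidHom :=
      exists_fixD_inrRange_subgroupOf p C hι hcharY hS (fun x => Env₀.recon.projG (Env₀.isoX x) = 1) hδ
    ∀ -- (R1) residual: the UNIQUENESS clause only («the unique order two `Δ`-outer automorphism over `G_k`», tempered-anabelian)
      (huniq : ∀ κ : (EtaleThetaDataOfSetting.Pi C) ≃ₜ* (EtaleThetaDataOfSetting.Pi C),
        (∀ x, Env₀.recon.projG (Env₀.isoX (κ x)) = Env₀.recon.projG (Env₀.isoX x)) →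
        (∃ δ' : EtaleThetaDataOfSetting.Pi C, Env₀.recon.projG (Env₀.isoX δ') = 1 ∧ ∀ x, κ (κ x) = δ' * x * δ'⁻¹) →
        (¬ ∃ δ' : EtaleThetaDataOfSetting.Pi C, Env₀.recon.projG (Env₀.isoX δ') = 1 ∧ ∀ x, κ x = δ' * x * δ'⁻¹) →
          ∃ δ' : EtaleThetaDataOfSetting.Pi C, Env₀.recon.projG (Env₀.isoX δ') = 1 ∧ ∀ x, κ x = δ' * α x * δ'⁻¹)
        ,
    -- «STANDARD TYPE AT `D_{μ_-}`», NOW A THEOREM: `etaStd :=` the ROOT member of the orbit `η̈^{Θ,l·ℤ×μ₂}` (σ₀ = 1); its restriction to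
    -- `D_{μ_-} ⊆ inr(G_{ℚ_p})` is `2l`-torsion because `η̈♯ = infl(z-class)` DIES on the Galois section (`hstd_rootMember_of_section`)
    let etaStd : (EtaleThetaDataOfSetting.coh C).H1 ⊤ :=
      (EtaleThetaDataOfSetting.h1Top C).symm (Additive.ofMul (EtaleThetaDataOfSetting.rootLiftClass C))
    let hmem : etaStd ∈ EtaleThetaDataOfSetting.orbitOne C hC :=
      ⟨1, by haveI := EtaleThetaDataOfSetting.piYdd_normal C hC; rw [ContH1.conj_one_apply]⟩
    let hstd : (2 * (EtaleLevels.setting C hC hS hlp hp2 hpl hζ τ.modAll f hf).l) •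
        EtaleThetaDataOfSetting.resDmuOf C Dμ hDmu etaStd = 0 :=
      hstd_rootMember_of_section p 1 2 even_two C rfl Dμ hDmu fun d hd => (mem_inrRange_subgroupOf_iff p 1 2 even_two C d).1 hd
    -- THE COEFFICIENT HALF OF THE PAIR, NOW A THEOREM: `β := ι^Θ`, abc-iut's `thetaCompanionOfAut` of the stage-2 inversion
    -- (`IsInversionAut.map_deltaTemp`, `hasThetaTopology_modelχq`); `hφ` by construction, `hβ` = `thetaIso_inversionχq_apply_eq_self`
    let cι := (ThetaSetting.modelχq p 1 2 even_two).thetaCompanionOfAut ι hιA.map_deltaTemp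
      (hasThetaTopology_modelχq p 1 2 even_two).isQuotientMap_toTheta
    let β : (ThetaSetting.modelχq p 1 2 even_two).GtpTheta ≃ₜ* (ThetaSetting.modelχq p 1 2 even_two).GtpTheta := cι.thetaIso
    let hφ : ∀ g, β (EtaleThetaDataOfSetting.phi C g) = EtaleThetaDataOfSetting.phi C (α g) := fun g => by
      change cι.thetaIso ((ThetaSetting.modelχq p 1 2 even_two).toTheta (g : PiTpχq p 1 2)) =
        (ThetaSetting.modelχq p 1 2 even_two).toTheta ((α g : EtaleThetaDataOfSetting.Pi C) : PiTpχq p 1 2)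
      rw [EtaleThetaDataOfSetting.coe_inversionAlpha]
      exact (ThetaSetting.modelχq p 1 2 even_two).thetaCompanionOfAut_thetaIso_toTheta ι hιA.map_deltaTemp _ _
    let hβ : ∀ a : (ThetaSetting.modelχq p 1 2 even_two).GtpTheta, a ∈ (ThetaSetting.modelχq p 1 2 even_two).lDeltaTheta l → β a = a :=
      fun a ha => thetaIso_inversionχq_apply_eq_self p 1 2 even_two cι ((ThetaSetting.modelχq p 1 2 even_two).lDeltaTheta_le l ha)
    -- THE PROP. 2.2 (ii) TRANSLATES OF THE STANDARD CLASS `tr n := γⁿ · η̲̈^Θ` (the `γⁿ`-conjugates of the root class) with `htr`,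
    -- `hdesc`, `hrev`, `hfree` are THEOREMS here (built in the proof: `translates_rootMember_modelχq`, with [EtTh] Prop. 1.5 (ii) for the
    -- section datum = abc-iut-L2-t8's `prop13_prop15_sectionData_modelTate`), so they no longer appear in the telescope.
    ∀ -- RESIDUAL, ALL ANABELIAN: (H1) `Δ` characteristic (⟺ MChar, p466815) and the isomorph `G` (the earlier `hP`, F-0620@1 `h218i₁`,
      -- F-2633 `hcharY`, (R1) `huniq`)
      (hΔX : ∀ φ : (EtaleLevels.setting C hC hS hlp hp2 hpl hζ τ.modAll f hf).PiX ≃ₜ* (EtaleLevels.setting C hC hS hlp hp2 hpl hζ τ.modAll f hf).PiX,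
        (EtaleLevels.setting C hC hS hlp hp2 hpl hζ τ.modAll f hf).DeltaX.map φ.toMulEquiv.toMonoidHom =
          (EtaleLevels.setting C hC hS hlp hp2 hpl hζ τ.modAll f hf).DeltaX)
      (G : IsoClass (EtaleLevels.setting C hC hS hlp hp2 hpl hζ τ.modAll f hf).Gk),
      haveI := finiteIndex_map_aug_inrRange_subgroupOf p 1 2 even_two C (inr_mem_Huuχq p 1 2 l hl)
      ∃ cU : CyclotomeCoefficients (EtaleThetaDataOfSetting.phi C) ((ThetaSetting.modelχq p 1 2 even_two).lDeltaTheta l) (PadicAlgCl p)ˣ,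
        Function.Bijective cU.hom ∧
        (∀ (ζ : Literature.AnabelianGeometry.EtaleTheta.cyclotome (PadicAlgCl p)ˣ) (M : ℕ+),
          (((τ.modAll M).red (cU.hom ζ) : MuN p M) : (PadicAlgCl p)ˣ) = (ζ : ℕ+ → (PadicAlgCl p)ˣ) M) ∧
        Literature.IUT.HodgeArakelov.Cor112_ii
          (EtaleLevels.thetaEvaluation C hC hS hlp hp2 hpl hζ τ.modAll f hf τ.red_modAll h15 L hZ hcharY (EtaleLevels.bijective_rigidLimHom C hC hS hlp hp2 hpl hζ τ.modAll f hf τ.red_modAll h15 L hZ) Env₀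
            (EtaleThetaDataOfSetting.pointedInversionOfPair C hC hS hcharY (EtaleLevels.setting C hC hS hlp hp2 hpl hζ τ.modAll f hf)
              (ContinuousMulEquiv.refl _) rfl Env₀ α hover 1 hδ hαα γ hγ hαγ huniq Dμ hDmu hfixD etaStd hmem hstd)
            (LevelRetraction.ofAugmentation (EtaleThetaDataOfSetting.phi C) ((ThetaSetting.modelχq p 1 2 even_two).lDeltaTheta l)
              (EtaleThetaDataOfSetting.aug C) Dμ (eq_one_of_mem_inrRange_subgroupOf_of_aug_eq_one p 1 2 even_two C) (EtaleThetaDataOfSetting.PiYdd C)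
              (EtaleThetaDataOfSetting.continuous_aug C) (EtaleLevels.aug_ker_acts_trivially C)
              (hlift_of_isCompact (EtaleThetaDataOfSetting.aug C) Dμ (EtaleThetaDataOfSetting.continuous_aug C) (isCompact_inrRange_subgroupOf p 1 2 even_two C (inr_mem_Huuχq p 1 2 l hl)))
              (hemb_of_isCompact (EtaleThetaDataOfSetting.aug C) Dμ (EtaleThetaDataOfSetting.continuous_aug C) (isCompact_inrRange_subgroupOf p 1 2 even_two C (inr_mem_Huuχq p 1 2 l hl)) (eq_one_of_mem_inrRange_subgroupOf_of_aug_eq_one p 1 2 even_two C)))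
            cU (EtaleThetaDataOfSetting.isOpen_stabilizer_units C) (EtaleThetaDataOfSetting.finiteIndex_stabilizer_units C)
            (unitGroup ℚ_[p] (PadicAlgCl p)) (EtaleThetaDataOfSetting.pairRhoLim C α β hφ (EtaleThetaDataOfSetting.mem_lDeltaTheta_iff_of_eq_self β hβ) (EtaleThetaDataOfSetting.mem_PiYdd_iff_of_piYddCharacteristic C hcharY α))) ∧
        ∃ Δ : MuXmuDiagram
            (EtaleLevels.thetaEvaluation C hC hS hlp hp2 hpl hζ τ.modAll f hf τ.red_modAll h15 L hZ hcharY (EtaleLevels.bijective_rigidLimHom C hC hS hlp hp2 hpl hζ τ.modAll f hf τ.red_modAll h15 L hZ) Env₀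
              (EtaleThetaDataOfSetting.pointedInversionOfPair C hC hS hcharY (EtaleLevels.setting C hC hS hlp hp2 hpl hζ τ.modAll f hf)
                (ContinuousMulEquiv.refl _) rfl Env₀ α hover 1 hδ hαα γ hγ hαγ huniq Dμ hDmu hfixD etaStd hmem hstd)
              (LevelRetraction.ofAugmentation (EtaleThetaDataOfSetting.phi C) ((ThetaSetting.modelχq p 1 2 even_two).lDeltaTheta l)
                (EtaleThetaDataOfSetting.aug C) Dμ (eq_one_of_mem_inrRange_subgroupOf_of_aug_eq_one p 1 2 even_two C) (EtaleThetaDataOfSetting.PiYdd C)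
                (EtaleThetaDataOfSetting.continuous_aug C) (EtaleLevels.aug_ker_acts_trivially C)
                (hlift_of_isCompact (EtaleThetaDataOfSetting.aug C) Dμ (EtaleThetaDataOfSetting.continuous_aug C) (isCompact_inrRange_subgroupOf p 1 2 even_two C (inr_mem_Huuχq p 1 2 l hl)))
                (hemb_of_isCompact (EtaleThetaDataOfSetting.aug C) Dμ (EtaleThetaDataOfSetting.continuous_aug C) (isCompact_inrRange_subgroupOf p 1 2 even_two C (inr_mem_Huuχq p 1 2 l hl)) (eq_one_of_mem_inrRange_subgroupOf_of_aug_eq_one p 1 2 even_two C)))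
              cU (EtaleThetaDataOfSetting.isOpen_stabilizer_units C) (EtaleThetaDataOfSetting.finiteIndex_stabilizer_units C)
              (unitGroup ℚ_[p] (PadicAlgCl p)) (EtaleThetaDataOfSetting.pairRhoLim C α β hφ (EtaleThetaDataOfSetting.mem_lDeltaTheta_iff_of_eq_self β hβ) (EtaleThetaDataOfSetting.mem_PiYdd_iff_of_piYddCharacteristic C hcharY α)))
            (AbsTopMonoids.genuineOfModelIsm (EtaleLevels.setting C hC hS hlp hp2 hpl hζ τ.modAll f hf) (ThetaSetting.modelχq p 1 2 even_two).toTemperedCurve.mlfClosurePadic (ThetaSetting.modelχq p 1 2 even_two).toTemperedCurve.galoisEpsilonPadic hΔX hq) G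
            ↥(AddCommGroup.torsion (EtaleLevels.thetaEnvData C hC hS hlp hp2 hpl hζ τ.modAll f hf τ.red_modAll h15 L hZ hcharY (EtaleLevels.bijective_rigidLimHom C hC hS hlp hp2 hpl hζ τ.modAll f hf τ.red_modAll h15 L hZ)).cohEnv.lim)
            (AddCommGroup.torsion (EtaleLevels.thetaEnvData C hC hS hlp hp2 hpl hζ τ.modAll f hf τ.red_modAll h15 L hZ hcharY (EtaleLevels.bijective_rigidLimHom C hC hS hlp hp2 hpl hζ τ.modAll f hf τ.red_modAll h15 L hZ)).cohEnv.lim).subtype,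
          Δ.poly₄₅ = {e | ∃ (φ : AbsTopMonoids.Genuine.qObj hq (IsoClass.base (EtaleLevels.setting C hC hS hlp hp2 hpl hζ τ.modAll f hf).PiX) ⟶ G)
              (gI : (AbsTopMonoids.genuineOfModelIsm (EtaleLevels.setting C hC hS hlp hp2 hpl hζ τ.modAll f hf) (ThetaSetting.modelχq p 1 2 even_two).toTemperedCurve.mlfClosurePadic
                (ThetaSetting.modelχq p 1 2 even_two).toTemperedCurve.galoisEpsilonPadic hΔX hq).Ism G),
            ∀ (u : ↥(unitGroup ℚ_[p] (PadicAlgCl p)))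
              (m : ↥(EtaleLevels.thetaEvaluation C hC hS hlp hp2 hpl hζ τ.modAll f hf τ.red_modAll h15 L hZ hcharY (EtaleLevels.bijective_rigidLimHom C hC hS hlp hp2 hpl hζ τ.modAll f hf τ.red_modAll h15 L hZ) Env₀
                (EtaleThetaDataOfSetting.pointedInversionOfPair C hC hS hcharY (EtaleLevels.setting C hC hS hlp hp2 hpl hζ τ.modAll f hf)
                  (ContinuousMulEquiv.refl _) rfl Env₀ α hover 1 hδ hαα γ hγ hαγ huniq Dμ hDmu hfixD etaStd hmem hstd)
                (LevelRetraction.ofAugmentation (EtaleThetaDataOfSetting.phi C) ((ThetaSetting.modelχq p 1 2 even_two).lDeltaTheta l)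
                  (EtaleThetaDataOfSetting.aug C) Dμ (eq_one_of_mem_inrRange_subgroupOf_of_aug_eq_one p 1 2 even_two C) (EtaleThetaDataOfSetting.PiYdd C)
                  (EtaleThetaDataOfSetting.continuous_aug C) (EtaleLevels.aug_ker_acts_trivially C)
                  (hlift_of_isCompact (EtaleThetaDataOfSetting.aug C) Dμ (EtaleThetaDataOfSetting.continuous_aug C) (isCompact_inrRange_subgroupOf p 1 2 even_two C (inr_mem_Huuχq p 1 2 l hl)))
                  (hemb_of_isCompact (EtaleThetaDataOfSetting.aug C) Dμ (EtaleThetaDataOfSetting.continuous_aug C) (isCompact_inrRange_subgroupOf p 1 2 even_two C (inr_mem_Huuχq p 1 2 l hl)) (eq_one_of_mem_inrRange_subgroupOf_of_aug_eq_one p 1 2 even_two C)))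
                cU (EtaleThetaDataOfSetting.isOpen_stabilizer_units C) (EtaleThetaDataOfSetting.finiteIndex_stabilizer_units C)
                (unitGroup ℚ_[p] (PadicAlgCl p)) (EtaleThetaDataOfSetting.pairRhoLim C α β hφ (EtaleThetaDataOfSetting.mem_lDeltaTheta_iff_of_eq_self β hβ) (EtaleThetaDataOfSetting.mem_PiYdd_iff_of_piYddCharacteristic C hcharY α))).MxTM)
              (w : (nonzeroIntegers (ThetaSetting.modelχq p 1 2 even_two).toTemperedCurve.mlfClosurePadic.k (ThetaSetting.modelχq p 1 2 even_two).toTemperedCurve.mlfClosurePadic.K)ˣ),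
              (m : (EtaleLevels.thetaEvaluation C hC hS hlp hp2 hpl hζ τ.modAll f hf τ.red_modAll h15 L hZ hcharY (EtaleLevels.bijective_rigidLimHom C hC hS hlp hp2 hpl hζ τ.modAll f hf τ.red_modAll h15 L hZ) Env₀
                (EtaleThetaDataOfSetting.pointedInversionOfPair C hC hS hcharY (EtaleLevels.setting C hC hS hlp hp2 hpl hζ τ.modAll f hf)
                  (ContinuousMulEquiv.refl _) rfl Env₀ α hover 1 hδ hαα γ hγ hαγ huniq Dμ hDmu hfixD etaStd hmem hstd)
                (LevelRetraction.ofAugmentation (EtaleThetaDataOfSetting.phi C) ((ThetaSetting.modelχq p 1 2 even_two).lDeltaTheta l)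
                  (EtaleThetaDataOfSetting.aug C) Dμ (eq_one_of_mem_inrRange_subgroupOf_of_aug_eq_one p 1 2 even_two C) (EtaleThetaDataOfSetting.PiYdd C)
                  (EtaleThetaDataOfSetting.continuous_aug C) (EtaleLevels.aug_ker_acts_trivially C)
                  (hlift_of_isCompact (EtaleThetaDataOfSetting.aug C) Dμ (EtaleThetaDataOfSetting.continuous_aug C) (isCompact_inrRange_subgroupOf p 1 2 even_two C (inr_mem_Huuχq p 1 2 l hl)))
                  (hemb_of_isCompact (EtaleThetaDataOfSetting.aug C) Dμ (EtaleThetaDataOfSetting.continuous_aug C) (isCompact_inrRange_subgroupOf p 1 2 even_two C (inr_mem_Huuχq p 1 2 l hl)) (eq_one_of_mem_inrRange_subgroupOf_of_aug_eq_one p 1 2 even_two C)))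
                cU (EtaleThetaDataOfSetting.isOpen_stabilizer_units C) (EtaleThetaDataOfSetting.finiteIndex_stabilizer_units C)
                (unitGroup ℚ_[p] (PadicAlgCl p)) (EtaleThetaDataOfSetting.pairRhoLim C α β hφ (EtaleThetaDataOfSetting.mem_lDeltaTheta_iff_of_eq_self β hβ) (EtaleThetaDataOfSetting.mem_PiYdd_iff_of_piYddCharacteristic C hcharY α))).Hd) =
                  Multiplicative.toAdd (h1LimKummer (EtaleThetaDataOfSetting.phi C) ((ThetaSetting.modelχq p 1 2 even_two).lDeltaTheta l) Dμ cU
                    (EtaleThetaDataOfSetting.isOpen_stabilizer_units C) (EtaleThetaDataOfSetting.finiteIndex_stabilizer_units C) u) →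
              ((w : nonzeroIntegers (ThetaSetting.modelχq p 1 2 even_two).toTemperedCurve.mlfClosurePadic.k (ThetaSetting.modelχq p 1 2 even_two).toTemperedCurve.mlfClosurePadic.K) :
                  (ThetaSetting.modelχq p 1 2 even_two).toTemperedCurve.mlfClosurePadic.K) = ((u : (PadicAlgCl p)ˣ) : PadicAlgCl p) →
                e (Multiplicative.ofAdd (QuotientAddGroup.mk m)) =
                  (AbsTopMonoids.genuineOfModelIsm (EtaleLevels.setting C hC hS hlp hp2 hpl hζ τ.modAll f hf) (ThetaSetting.modelχq p 1 2 even_two).toTemperedCurve.mlfClosurePadic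
                      (ThetaSetting.modelχq p 1 2 even_two).toTemperedCurve.galoisEpsilonPadic hΔX hq).actIsm G gI
                    (QuotientGroup.mk (Units.map (AbsTopMonoids.Genuine.liftM (ThetaSetting.modelχq p 1 2 even_two).toTemperedCurve.mlfClosurePadic
                      (AbsTopMonoids.Genuine.phiOf (ThetaSetting.modelχq p 1 2 even_two).toTemperedCurve.mlfClosurePadic (ThetaSetting.modelχq p 1 2 even_two).toTemperedCurve.galoisEpsilonPadic φ)).toMonoidHom w))} := by
  intro hC hS ι hιA Dsec K₀ C f hf h15 L hO hYcl hp2 hpl hζ hZ hq hι α hαα γ hγ hαγ hP Env₀ hδ h218i₁ hover hcharY Dμ hDmu hfixD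
    huniq etaStd hmem hstd cι β hφ hβ hΔX G
  -- [EtTh] Prop. 1.5 (ii) for the `inr`-section Kummer datum of record: abc-iut-L2-t8's theorem
  have h15ii : Literature.AnabelianGeometry.EtaleTheta.ThetaSetting.Prop15ii K₀ hC :=
    (prop13_prop15_sectionData_modelTate p SemidirectProduct.inr (continuous_inrχq p 1 2) (fun _ => rfl)
      (map_inr_GK_le_GtpY_modelχq' p 1 2 even_two) (map_inr_GKdd_le_GtpYdd_modelχq' p 1 2 even_two) hC).2.2.1
  haveI := EtaleThetaDataOfSetting.piYdd_normal C hC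
  haveI : ((ThetaSetting.modelχq p 1 2 even_two).lDeltaTheta l).Normal :=
    (ThetaSetting.modelχq p 1 2 even_two).lDeltaTheta_normal l
  haveI : IsMulCommutative ((ThetaSetting.modelχq p 1 2 even_two).lDeltaTheta l) :=
    EtaleThetaDataOfSetting.instIsMulCommutative_lDeltaTheta (D := ThetaSetting.modelχq p 1 2 even_two) l
  -- the translates of the root class and their three printed properties
  obtain ⟨hdesc, hrev, hfree⟩ := translates_rootMember_modelχq p 1 2 even_two C rfl hS h15 h15ii hι cι hcharY γ hγ hφ
    (EtaleThetaDataOfSetting.mem_lDeltaTheta_iff_of_eq_self β hβ)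
  refine cor112_model_modelTate_section_std p l hl hlp hdvd τ hP h218i₁ hcharY huniq hΔX
    (fun n => (EtaleThetaDataOfSetting.h1Top C).symm (Additive.ofMul
      (ContH1.conj (EtaleThetaDataOfSetting.phi C) ((ThetaSetting.modelχq p 1 2 even_two).lDeltaTheta l) (γ ^ n)
        (EtaleThetaDataOfSetting.rootLiftClass C)))) ?_ hdesc hrev hfree G
  -- `htr : tr 0 = etaStd` (`γ⁰ = 1` acts trivially)
  change (EtaleThetaDataOfSetting.h1Top C).symm (Additive.ofMul
    (ContH1.conj (EtaleThetaDataOfSetting.phi C) ((ThetaSetting.modelχq p 1 2 even_two).lDeltaTheta l) (γ ^ (0 : ℤ))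
      (EtaleThetaDataOfSetting.rootLiftClass C))) = _
  rw [zpow_zero, ContH1.conj_one_apply]

end Tate

end ModelTateCarriers

end Literature.IUT.HodgeArakelov

end
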